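import Mathlib
import HarnessLib
import Summits.NavierStokesRegularity.NavierStokesRegularity.Theorems.TaylorModelRungThreeCertificateCloserV
import Summits.NavierStokesRegularity.NavierStokesRegularity.Theorems.TaylorModelRungThreeCertificateFormatVGrowthCSound

/-!
# Crux K1b-DR (stmt-NavierStokesRegularity-23954), line `taylor-model` — v3 certificate: the CLOSER for the growth checker
# VARIANT C (interval chunk transfers; tm-g4 g5)

`CertTablesV.k1bDR_of_checksVRGC'` — `k1bDR_of_checksVRG'` (tree `…CertificateCloserV`) with the chunk runs
`growthRangeC … j L q` of `…CertificateFormatVGrowthC` (emitted INTERVAL transfer matrices `T_q`, cross-chunk factor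
`|P(b←C_q)|·|T_{q−1}⋯T_{c+1}|·ũ_a`) in place of `growthRange`; `G := GrC … L`, `ΛT := ΛTr`; every other binder verbatim.
A separate module so that nothing landed is touched. MODEL-lattice bookkeeping only (rung TL-M3); nothing here is a statement
about the Navier–Stokes equations; K1b-DR is NOT proved here (that needs an emitted certificate whose Booleans evaluate to `true`).
-/

-- the sub-problem namespace repeats the summit name by design (D-0017)
set_option linter.dupNamespace false

namespace Summit.NavierStokesRegularity.NavierStokesRegularity.Theorems.TaylorModelCert

namespace CertTablesV

variable (TV : CertTablesV) (kitOf : ℕ → CoreKit) (wT : ℕ → Array Dyad)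

/-- **THE v3 CLOSER FROM BOOLEANS, GROWTH VARIANT C** (interval chunk transfers): as `k1bDR_of_checksVRG'` with the chunk
runs `growthRangeC … j L q` (`G := GrC … L`). [folklore] -/
theorem k1bDR_of_checksVRGC' (sc : ScalarsV) (A : ReadoutAux QS2) (B : StageAux QS2) (B'' : StaticAux QS2)
    (hcoef : TV.base.checkCoef = true) (hS : TV.base.checkStatic B'' = true)
    (hSN : TV.base.checkStageNumerics A B = true) (hk : KitOK TV kitOf)
    (hnode0 : ∀ j, j ≤ TV.base.N₀ → nodeOK TV.base.n TV.prec (TV.ctxOfW kitOf wT j).N0 = true)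
    (hrB : ∀ j, j ≤ TV.base.N₀ → nonnegVec TV.base.n (TV.stageV j).rB = true)
    (hK : CoreChecksOK TV wT) (hE : ∀ j, j ≤ TV.base.N₀ → TV.checkEntryV j = true)
    (hchk' : TV.checkReadouts' kitOf wT A = true) {L : ℕ} (hL : 0 < L)
    (hGR : ∀ j, j ≤ TV.base.N₀ → ∀ q, q * L < TV.S j →
      TV.growthRangeC kitOf wT (fun _ co => TV.base.testR4 TV.MB (TV.AB j) co) j L q = true)
    (hcL : ∀ j, j ≤ TV.base.N₀ → TV.checkL1 j = true) (hc0 : ∀ j, j ≤ TV.base.N₀ → TV.checkR0 j = true)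
    (hc1 : ∀ j, j ≤ TV.base.N₀ → TV.checkR1 wT j = true) :
    Summit.NavierStokesRegularity.NavierStokesRegularity.Theses.ExactWindowRungThree.DerivativeEnclosureCertificateR :=
  have hsteps := steps_of_growthC (TV := TV) (kitOf := kitOf) (wT := wT)
    (Pj := fun j _ co => TV.base.testR4 TV.MB (TV.AB j) co) hL hGR
  TV.k1bDR_of_checksVR' kitOf wT sc A B B'' hcoef hS hSN hk ⟨hnode0, hrB, fun j hj s hs => (hsteps j hj s hs).1⟩ hK hE hchk'
    (fun j hj s hs => (hsteps j hj s hs).2) (G := fun j => TV.GrC kitOf wT j L) (ΛT := TV.ΛTr)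
    (hR0_all (sc := sc) hc0) (hR1_all (sc := sc) hc1)
    (hR2_allC (sc := sc) hL hGR (TV.stageNumerics_of_checkV kitOf wT sc A B hcoef hSN))
    (hR3a_allC (sc := sc) hL hGR) (hR3b_allC (sc := sc) hL hcL hGR)

end CertTablesV

end Summit.NavierStokesRegularity.NavierStokesRegularity.Theorems.TaylorModelCert
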